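import Summits.NavierStokesRegularity.FunctionalMining.NoGo.TopBotEigSaturatingSup
import Summits.NavierStokesRegularity.FunctionalMining.NoGo.TopBotEigHeatWindow
import Summits.NavierStokesRegularity.FunctionalMining.NoGo.TopBotEigHeatCoerciveTwo
import Summits.NavierStokesRegularity.FunctionalMining.NoGo.TopBotEigHeatCoerciveTwoSharp
import HarnessLib

/-!
# FunctionalMining — K1-Q6 (c) at `q = 2` in the kernel: the candidate law of the symmetrised core
# `Φ₂ + Ψ₂` HOLDS, with the sharp heat rate `8π²/3` and the window `C_λ^sym(2) ∈ [8π²/3, 8π²]`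

HONEST FRAMING. Search for candidate a priori estimates; no regularity claim. Cell `pub-nsfunc`, prove
seat (gen 26). This file is pure COMPOSITION of four tree files of the no-go seat, filed byte-identical by
the prove seat under `FunctionalMining/NoGo/` (REQUESTS #19–#22): nothing new is computed here; the point
is that the dictionary's `@[conjecture]` node `TopBotEigMomentLaw 2` (`SpectralMixtureCandidates.lean`,
door D-K6 escape (c) of `pub-nsfunc/NOGO.md`) is now a kernel THEOREM by name, and that the symmetrised
heat constant `C_λ^sym(2) = topBotEigHeatRate 2` has a two-sided kernel window.

THE CHAIN (all `T³ = UnitAddTorus (Fin 3)`, smooth divergence-free fields; `Φ₂ = ∫(λ₁⁺)²(S)`,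
`Ψ₂ = ∫((−λ₃)⁺)²(S)`, `Z₂ = ∫|S|²`, `D₂ = ∫|∇S|²`, `T_Φ(v) = heatDissipation Φ v` the heat price):
* K7 `NoGo/TopBotEigHeatCoerciveTwo` (nogo g37): the pointwise identity `λ₁² + λ₃² = |S|²/3 + (4/3)g²`
  (`g = (λ₁ − λ₃)/2`), hence `Φ₂ + Ψ₂ ≤ Z₂` (`topBotEigMoment_two_le`) and the DISSIPATION IDENTITY
  `T_{Φ₂+Ψ₂} = (2/3)·D₂ + (4/3)·T_G` with `T_G ≥ 0` (`heatDissipation_topBotEigMoment_two`,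
  `heatDissipation_gapMoment_nonneg`) — so `(2/3)·D₂ ≤ T_{Φ₂+Ψ₂}`
  (`two_thirds_strainGradDissipation_le_heatDissipation_two` below);
* K8 `NoGo/TopBotEigHeatCoerciveTwoSharp` (nogo g37): the SHARP Poincaré row of the strain
  `4π²·Z₂ ≤ D₂` (`four_pi_sq_mul_strainMoment_two_le`), packaged as
  `topBotEigMoment_two_heatCoercive_sharp_of : (Φ₂+Ψ₂ ≤ Z₂) → ((2/3)D₂ ≤ T) → HeatCoercive (Φ₂+Ψ₂) (8π²/3)`;
* K5 `NoGo/TopBotEigSaturatingSup` (nogo g36): `topBotEigMomentLaw_of_heatCoercivePos :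
  2 ≤ q → TopBotEigHeatCoercivePos q → TopBotEigMomentLaw q` (Theorem G (ii) for the symmetrised core);
* K6 `NoGo/TopBotEigHeatWindow` (nogo g36): `topBotEigHeatRate q := heatRate (topBotEigMoment q)`,
  `topBotEigHeatCoercive_iff_le_rate : HeatCoercive (Φ_q+Ψ_q) c ↔ c ≤ C_λ^sym(q)` and the ceiling
  `topBotEigHeatRate_le : C_λ^sym(q) ≤ 4π²q` (single-shell crossed shear).

CONTENT (this file; namespace `Summit.NavierStokesRegularity.FunctionalMining.TopEig`):
* `two_thirds_strainGradDissipation_le_heatDissipation_two` — `(2/3)·D₂(v) ≤ T_{Φ₂+Ψ₂}(v)`;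
* `topBotEigMoment_two_heatDissipation_ge_sharp` — `(8π²/3)·(Φ₂+Ψ₂)(v) ≤ T_{Φ₂+Ψ₂}(v)` pointwise in `v`;
* **`topBotEigMoment_two_heatCoercive_sharp : HeatCoercive (Φ₂+Ψ₂) (8π²/3)`** (J1 of the no-go seat's
  joint check `sieveld/ktd/K7K8.JOINT.lean`, now on the tree);
* **`topBotEigMomentLaw_two : TopBotEigMomentLaw (d := Fin 3) 2`** (J1 of `sieveld/ktc/K5K7.JOINT.lean`) —
  THE `q = 2` ROW OF K1-Q6 (c): `∃ κ ≥ 0, SaturatingLawSup (Φ₂+Ψ₂) 1 3 κ`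
  (`topBotEigMoment_two_saturatingLawSup`: the exponents `(σ, γ) = (2q−3, (3q−3)/(2q−3)) = (1, 3)` by value);
* **`topBotEigHeatRate_two_mem_Icc : topBotEigHeatRate 2 ∈ Set.Icc (8π²/3) (8π²)`** ((W1) of
  `sieveld/kte/K6K7K8.JOINT.lean`) — the kernel window for `C_λ^sym(2)`, with its two by-value readings
  `topBotEigMoment_two_heatCoercive_of_le` (every `c ≤ 8π²/3` is an admissible rate) and
  `not_topBotEigMoment_two_heatCoercive_of_lt` (no `c > 8π²` is).

NOT CLAIMED. The value of `C_λ^sym(2)` inside `[8π²/3, 8π²]` (losses: `T_G ≥ 0` dropped; `Φ₂+Ψ₂ ≤ Z₂`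
where pointwise `λ₁² + λ₃² ∈ [5/6, 1]·|S|²`); anything at `q ≠ 2` (the node `TopBotEigHeatCoercivePos q`
for `q > 2` is reduced to the typed obligation `TopBotEigSplitting q c` in `NoGo/TopBotEigHeatCoerciveSplit`,
open); anything one-sided (`TopEigHeatCoercivePos`, `TopEigGapCoerciveTwo η`); nothing about Navier–Stokes
regularity — `TopBotEigMomentLaw 2` is an a priori differential inequality
`R ≤ κ ν⁻³ (2ℰ) (Φ₂+Ψ₂)^{1+1}` for the one-sided derivative values of `Φ₂ + Ψ₂` along smooth solutions
(`SaturatingLawSup`, exponents `σ = 1`, `γ = 3`), a candidate-estimate bookkeeping statement. [ours]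
-/

noncomputable section

open MeasureTheory Set
open scoped Real

namespace Summit.NavierStokesRegularity.FunctionalMining

open Literature.Analysis.FunctionSpaces Literature.Analysis.FunctionSpaces.Torus

namespace TopEig

open StrainL4 StrainMoment

variable {v : UnitAddTorus (Fin 3) → EuclideanSpace ℝ (Fin 3)}

/-! ## 1. The sharp heat rate of `Φ₂ + Ψ₂` -/

/-- `(2/3)·D₂(v) ≤ T_{Φ₂+Ψ₂}(v)` for smooth divergence-free `v` on `T³`: K7's dissipation identity
`T_{Φ₂+Ψ₂} = (2/3)D₂ + (4/3)T_G` with the sieve `T_G ≥ 0`. [ours, composition of K7] -/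
theorem two_thirds_strainGradDissipation_le_heatDissipation_two (hv : Torus.IsSmooth v)
    (hdiv : Torus.IsDivFree v) :
    2 / 3 * strainGradDissipation 2 v ≤ heatDissipation (topBotEigMoment (d := Fin 3) 2) v := by
  rw [heatDissipation_topBotEigMoment_two hv hdiv]
  have hG := heatDissipation_gapMoment_nonneg hv hdiv
  linarith

/-- **The sharp floor, field by field:** `(8π²/3)·(Φ₂+Ψ₂)(v) ≤ T_{Φ₂+Ψ₂}(v)` for every smooth
divergence-free `v` on `T³` (no zero-mean hypothesis needed: the strain has zero mean by itself).
Chain: `Φ₂+Ψ₂ ≤ Z₂` (K7), `4π²Z₂ ≤ D₂` (K8), `(2/3)D₂ ≤ T` (K7). [ours, composition of K7 + K8] -/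
theorem topBotEigMoment_two_heatDissipation_ge_sharp (hv : Torus.IsSmooth v)
    (hdiv : Torus.IsDivFree v) :
    8 * π ^ 2 / 3 * topBotEigMoment (d := Fin 3) 2 v ≤
      heatDissipation (topBotEigMoment (d := Fin 3) 2) v := by
  have h1 := four_pi_sq_mul_strainMoment_two_le hv
  have h2 := topBotEigMoment_two_le hv hdiv
  have h3 := two_thirds_strainGradDissipation_le_heatDissipation_two hv hdiv
  have hπ : 0 ≤ π ^ 2 := sq_nonneg _
  have h4 : π ^ 2 * topBotEigMoment (d := Fin 3) 2 v ≤ π ^ 2 * torusStrainMoment 2 v :=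
    mul_le_mul_of_nonneg_left h2 hπ
  linarith

/-- **`HeatCoercive (Φ₂ + Ψ₂) (8π²/3)`** — the symmetrised core is heat-coercive on `T³` at the sharp
rate `8π²/3` (a third of the single-shell value `8π²`), UNCONDITIONALLY: K8's packaged form fed with K7's
two facts. (J1 of the no-go seat's `sieveld/ktd/K7K8.JOINT.lean`.) [ours, composition of K7 + K8] -/
theorem topBotEigMoment_two_heatCoercive_sharp :
    HeatCoercive (d := Fin 3) (topBotEigMoment 2) (8 * π ^ 2 / 3) :=
  topBotEigMoment_two_heatCoercive_sharp_of (fun _ hw hdiv => topBotEigMoment_two_le hw hdiv)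
    (fun _ hw hdiv => two_thirds_strainGradDissipation_le_heatDissipation_two hw hdiv)

/-! ## 2. K1-Q6 (c) at `q = 2`: the law -/

/-- **`TopBotEigMomentLaw 2` — the candidate law K1-Q6 (c) HOLDS at `q = 2`:**
`∃ κ ≥ 0, SaturatingLawSup (Φ₂ + Ψ₂) (2·2−3) ((3·2−3)/(2·2−3)) κ`. The dictionary's `@[conjecture]` node
(`SpectralMixtureCandidates.lean`, door D-K6 escape (c)) at the row `q = 2`, by K5's Theorem G (ii) for
the symmetrised core (`topBotEigMomentLaw_of_heatCoercivePos`) and K7's heat node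
(`topBotEigHeatCoercivePos_two`). (J1 of the no-go seat's `sieveld/ktc/K5K7.JOINT.lean`.)
[ours, composition of K5 + K7] -/
theorem topBotEigMomentLaw_two : TopBotEigMomentLaw (d := Fin 3) 2 :=
  topBotEigMomentLaw_of_heatCoercivePos (by norm_num) topBotEigHeatCoercivePos_two

/-- The same law with the exponents BY VALUE: `(σ, γ) = (1, 3)` for `Φ₂ + Ψ₂`.
[ours, composition of K5 + K7] -/
theorem topBotEigMoment_two_saturatingLawSup :
    ∃ κ : ℝ, 0 ≤ κ ∧ SaturatingLawSup (d := Fin 3) (topBotEigMoment 2) 1 3 κ :=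
  topBotEigMoment_saturatingLawSup_rows.1 topBotEigHeatCoercivePos_two

/-- The law fed with the SHARP heat rate `8π²/3` through K5's rate form (the constant `κ` it produces is
existential in the tree; only its dependence on the rate is by name). [ours, composition of K5 + K7 + K8] -/
theorem topBotEigMoment_two_saturatingLawSup_of_sharp :
    ∃ κ : ℝ, 0 ≤ κ ∧
      SaturatingLawSup (d := Fin 3) (topBotEigMoment 2) (2 * 2 - 3) ((3 * 2 - 3) / (2 * 2 - 3)) κ :=
  topBotEigMoment_saturatingLawSup_of_heatCoercive (by norm_num) (by positivity)
    topBotEigMoment_two_heatCoercive_sharp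

/-! ## 3. The kernel window for `C_λ^sym(2)` -/

/-- **THE WINDOW BY NAME: `C_λ^sym(2) = topBotEigHeatRate 2 ∈ [8π²/3, 8π²]`.** Lower end: the sharp
rate (§1) through K6's `topBotEigHeatCoercive_iff_le_rate`; upper end: K6's ceiling
`topBotEigHeatRate_le` (`4π²·q` at `q = 2`, the single-shell crossed shear). ((W1) of the no-go seat's
`sieveld/kte/K6K7K8.JOINT.lean`.) [ours, composition of K6 + K7 + K8] -/
theorem topBotEigHeatRate_two_mem_Icc :
    topBotEigHeatRate 2 ∈ Set.Icc (8 * π ^ 2 / 3) (8 * π ^ 2) := by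
  refine ⟨(topBotEigHeatCoercive_iff_le_rate (by norm_num)).1
    topBotEigMoment_two_heatCoercive_sharp, ?_⟩
  have h := topBotEigHeatRate_le (q := 2) (by norm_num)
  linarith

/-- The window BY VALUE: `C_λ^sym(2)` unfolded to the `sSup` of the admissible heat rates of `Φ₂ + Ψ₂`.
[ours, bookkeeping] -/
theorem sSup_heatCoercive_topBotEigMoment_two_mem_Icc :
    sSup {c : ℝ | HeatCoercive (d := Fin 3) (topBotEigMoment 2) c} ∈
      Set.Icc (8 * π ^ 2 / 3) (8 * π ^ 2) := by
  rw [← topBotEigHeatRate_eq_sSup]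
  exact topBotEigHeatRate_two_mem_Icc

/-- Every rate `c ≤ 8π²/3` is admissible for `Φ₂ + Ψ₂` (K6's closed-ray structure of the admissible
rates + the sharp rate). [ours, bookkeeping] -/
theorem topBotEigMoment_two_heatCoercive_of_le {c : ℝ} (hc : c ≤ 8 * π ^ 2 / 3) :
    HeatCoercive (d := Fin 3) (topBotEigMoment 2) c :=
  (topBotEigHeatCoercive_iff_le_rate (by norm_num)).2 (hc.trans topBotEigHeatRate_two_mem_Icc.1)

/-- No rate `c > 8π²` is admissible for `Φ₂ + Ψ₂` (K6's ceiling `4π²·q` at `q = 2`, by value).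
[ours, bookkeeping] -/
theorem not_topBotEigMoment_two_heatCoercive_of_lt {c : ℝ} (hc : 8 * π ^ 2 < c) :
    ¬ HeatCoercive (d := Fin 3) (topBotEigMoment 2) c :=
  not_topBotEigHeatCoercive_of_lt (q := 2) (by norm_num) (by linarith)

end TopEig

end Summit.NavierStokesRegularity.FunctionalMining

end
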